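import Summits.ResolutionOfSingularities.ResolutionOfSingularities.Theorems.MarkedTransferCampaignW24ReducedRunDeath
import Mathlib.RingTheory.PowerSeries.Expand
import HarnessLib

/-!
# BOUNDARY RENORMALISATION OF THE UNIVERSAL REDUCED CASE-(I) RUN — after a digit `≡ −1 (mod p^a)` the run IS the run of the
# contracted bottom class in the variable `u = t^{p^a}`
# (HIRONAKA-L, kernel support in the OURS reduced model of slot W2.4 / RD-2′ (`CampaignW24.ReducedRun`); res-type-059 g14;
# companion of `MarkedTransferCampaignW24ReducedRunUniversal.lean`; imports res-L1-type-o6's `…ReducedRunDeath.lean` for `univStep_zero'`)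

**HONEST FRAMING.** OURS throughout: kernel theorems about the one-variable reduced model (`univStep` / `univRun` of
`MarkedTransferCampaignW24ReducedRunUniversal.lean`, res-D-pv-035 AS res-L1-k24). Nothing below is a statement of
[Hironaka2017] (lit key `paper:url-3343fd9e678b`), nothing asserts that any statement of it holds, nothing is a claim about
resolution of singularities in characteristic `p`; the manuscript stays «under review» (D-0012/D-0089). AI work, weaker than
expert review. The theorems explain the self-similar digit tails seen in the M48 «UNIVRUN CENSUS» (kit j276126 / j277234):
e.g. at `p = 5` the 32 census cases left open at precision `N = 15 625` continue `…, 374, 624 = 5⁴−1, 1249, 1874, 2499, 3124 = 5⁵−1, …`.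

## What is proved (`K` a field of characteristic `p`, `q = p^a`, any `a`)

* **Lucas at a digit `≡ −1 (mod q)`** `natCast_choose_mul_add_sub_one`: `C(m, q·j + (q−1)) = [m ≡ −1 (mod q)]·C(m / q, j)` in `K`.
* **(R) RENORMALISATION** `exists_univRun_eq_mul_expand`: if `ord G = q·j₀ + (q−1)` and `Gt` is the contraction of the bottom
  residue class (`coeff r Gt = coeff (q·r + (q−1)) G`), then for every `i` there is `F` with
  `univRun G i = G · F(t^q)` and `univRun Gt i = Gt · F` — the run from `G` is the run from `Gt` read through `u = t^q`.
  Consequences: `univRun_eq_zero_iff` (the run from `G` dies exactly when the run from `Gt` dies) and `order_univRun_renorm`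
  (digits: `ord (univRun G i) = (q − 1) + q · ord (univRun Gt i)`).
* The symmetries `g ↦ c·g(λt)` and the IMMORTALITY CRITERION built on (R) are in the companion
  `MarkedTransferCampaignW24ReducedRunRenormCycle.lean`.
Hypotheses: each theorem's own binders; no FACT-LIST fact, no DEFECT binder; no new definitions. Standard axioms.
-/

noncomputable section

set_option linter.dupNamespace false -- mandated namespace of this single-conjunct summit

namespace Summit.ResolutionOfSingularities.ResolutionOfSingularities.Theorems

namespace CampaignW24

namespace ReducedRun

open PowerSeries

universe u

/-! ## Lucas at a bottom digit `≡ −1 (mod p^a)` -/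

section Lucas

variable (p : ℕ) [hp : Fact p.Prime]

/-- **Lucas at a digit `≡ −1 (mod q)`, `q = p^a`:** `C(m, q·j + (q−1)) ≡ C(m / q, j)` if `m ≡ −1 (mod q)` and `≡ 0`
otherwise (the low `a` digits of `q·j + (q−1)` are all `p − 1`). [cite: Abad2019pBases, Lemma 6.2 (Lucas arithmetic; kernel bookkeeping)] -/
theorem choose_mul_add_sub_one_modEq (a j m : ℕ) :
    m.choose (p ^ a * j + (p ^ a - 1)) ≡ (if m % p ^ a = p ^ a - 1 then (m / p ^ a).choose j else 0) [MOD p] := by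
  have hq : 0 < p ^ a := pow_pos hp.out.pos a
  have h := Literature.RingTheory.MvPowerSeries.choose_add_pow_mul_add_pow_mul_modEq (p := p) a (m / p ^ a) j
    (Nat.mod_lt m hq) (Nat.sub_lt hq one_pos)
  rw [Nat.mod_add_div, add_comm (p ^ a - 1)] at h
  refine h.trans ?_
  have hlt : m % p ^ a < p ^ a := Nat.mod_lt m hq
  by_cases hc : m % p ^ a = p ^ a - 1
  · rw [if_pos hc, hc, Nat.choose_self, one_mul]
  · rw [if_neg hc, Nat.choose_eq_zero_of_lt (by omega), zero_mul]

/-- The same, cast into a ring of characteristic `p`. [cite: Abad2019pBases, Lemma 6.2 (Lucas arithmetic; kernel bookkeeping)] -/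
theorem natCast_choose_mul_add_sub_one {A : Type u} [CommRing A] [CharP A p] (a j m : ℕ) :
    ((m.choose (p ^ a * j + (p ^ a - 1)) : ℕ) : A) = if m % p ^ a = p ^ a - 1 then (((m / p ^ a).choose j : ℕ) : A) else 0 := by
  have h := CharP.natCast_eq_natCast' A p (choose_mul_add_sub_one_modEq p a j m)
  rw [h]
  split_ifs <;> simp

end Lucas

/-! ## Series with no bottom-class exponents, and the divided derivative at a digit `≡ −1 (mod q)` -/

section NoClass

variable {A : Type u} [CommRing A]

/-- If `R` has no coefficients on the exponents `≡ −1 (mod q)` then neither has `R · F(t^q)`. [folklore] -/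
theorem coeff_mul_expand_eq_zero_of_mod {q : ℕ} (hq : q ≠ 0) {R : A⟦X⟧} (hR : ∀ m, m % q = q - 1 → coeff m R = 0)
    (F : A⟦X⟧) (m : ℕ) (hm : m % q = q - 1) : coeff m (R * expand q hq F) = 0 := by
  rw [coeff_mul]
  refine Finset.sum_eq_zero fun x hx => ?_
  rw [Finset.HasAntidiagonal.mem_antidiagonal] at hx
  rw [coeff_expand]
  split_ifs with hd
  · obtain ⟨c, hc⟩ := hd
    have hx1 : x.1 % q = q - 1 := by
      rw [← hm, ← hx, hc, Nat.add_mul_mod_self_left]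
    rw [hR _ hx1, zero_mul]
  · rw [mul_zero]

variable (p : ℕ) [hp : Fact p.Prime] [CharP A p]

/-- At a digit `k = q·j + (q−1)`, `D^{(k)}` KILLS every series with no exponents `≡ −1 (mod q)` (Lucas). [folklore] -/
theorem D_eq_zero_of_mod {a j : ℕ} {S : A⟦X⟧} (hS : ∀ m, m % p ^ a = p ^ a - 1 → coeff m S = 0) :
    D (p ^ a * j + (p ^ a - 1)) S = 0 := by
  ext n
  rw [coeff_D, map_zero, natCast_choose_mul_add_sub_one p]
  split_ifs with hc
  · rw [hS _ hc, mul_zero]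
  · rw [zero_mul]

/-- At a digit `k = q·j + (q−1)`, `D^{(k)}(t^{q−1}·W(t^q)) = (D^{(j)} W)(t^q)`: on the bottom class the divided derivative
acts as the divided derivative in the variable `u = t^q` (Lucas). [folklore] -/
theorem D_X_pow_mul_expand {a j : ℕ} (W : A⟦X⟧) :
    D (p ^ a * j + (p ^ a - 1)) (X ^ (p ^ a - 1) * expand (p ^ a) (pow_ne_zero a hp.out.ne_zero) W) =
      expand (p ^ a) (pow_ne_zero a hp.out.ne_zero) (D j W) := by
  have hq : 0 < p ^ a := pow_pos hp.out.pos a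
  ext n
  rw [coeff_D, coeff_X_pow_mul', if_pos (by omega), natCast_choose_mul_add_sub_one p, coeff_expand, coeff_expand]
  by_cases hd : p ^ a ∣ n
  · obtain ⟨c, hc⟩ := hd
    subst hc
    have h1 : (p ^ a * c + (p ^ a * j + (p ^ a - 1))) % p ^ a = p ^ a - 1 := by
      rw [← add_assoc, ← mul_add, Nat.mul_add_mod, Nat.mod_eq_of_lt (Nat.sub_lt hq one_pos)]
    have h2 : (p ^ a * c + (p ^ a * j + (p ^ a - 1))) / p ^ a = c + j := by
      rw [← add_assoc, ← mul_add, Nat.mul_add_div hq, Nat.div_eq_of_lt (Nat.sub_lt hq one_pos), add_zero]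
    have h3 : p ^ a * c + (p ^ a * j + (p ^ a - 1)) - (p ^ a - 1) = p ^ a * (c + j) := by
      rw [← add_assoc, ← mul_add, Nat.add_sub_cancel]
    rw [if_pos h1, h2, h3, if_pos (dvd_mul_right _ _), if_pos (dvd_mul_right _ _), Nat.mul_div_cancel_left _ hq,
      Nat.mul_div_cancel_left _ hq, coeff_D]
  · have h1 : (n + (p ^ a * j + (p ^ a - 1))) % p ^ a ≠ p ^ a - 1 := by
      intro h
      apply hd
      have h' : (n + (p ^ a * j + (p ^ a - 1))) % p ^ a = (n % p ^ a + (p ^ a - 1)) % p ^ a := by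
        rw [add_comm (p ^ a * j), ← add_assoc, Nat.add_mul_mod_self_left, Nat.add_mod, Nat.mod_eq_of_lt (Nat.sub_lt hq one_pos)]
      rw [h'] at h
      -- `(r + (q-1)) % q = q - 1` with `r < q` forces `r = 0`
      have hr : n % p ^ a < p ^ a := Nat.mod_lt n hq
      have : n % p ^ a = 0 := by
        by_contra h0
        have hge : p ^ a ≤ n % p ^ a + (p ^ a - 1) := by omega
        rw [Nat.mod_eq_sub_mod hge, Nat.mod_eq_of_lt (by omega)] at h
        omega
      exact Nat.dvd_of_mod_eq_zero this
    rw [if_neg h1, zero_mul, if_neg hd]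

end NoClass

/-! ## (R) Renormalisation at a bottom digit `≡ −1 (mod q)` -/

section Renorm

variable {K : Type u} [Field K] (p : ℕ) [hp : Fact p.Prime]

/-- The unit part of the bottom class `q − 1` is the `q`-expansion of the contracted class `Gt`
(`coeff r Gt = coeff (q·r + (q−1)) G`). [folklore] -/
theorem unitPart_eq_expand {a : ℕ} {G Gt : K⟦X⟧} (hGt : ∀ r, coeff r Gt = coeff (p ^ a * r + (p ^ a - 1)) G) :
    unitPart (p ^ a) (p ^ a - 1) G = expand (p ^ a) (pow_ne_zero a hp.out.ne_zero) Gt := by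
  ext m
  rw [coeff_unitPart, coeff_expand]
  split_ifs with hd
  · obtain ⟨c, hc⟩ := hd
    subst hc
    rw [Nat.mul_div_cancel_left _ (pow_pos hp.out.pos a), hGt, add_comm]
  · rfl

/-- The remainder `G − classPart_{q−1} G` has no exponents `≡ −1 (mod q)`. [folklore] -/
theorem coeff_sub_classPart_eq_zero {q : ℕ} (hq : 0 < q) (G : K⟦X⟧) (m : ℕ) (hm : m % q = q - 1) :
    coeff m (G - classPart q (q - 1) G) = 0 := by
  rw [map_sub, coeff_classPart, Nat.mod_eq_of_lt (Nat.sub_lt hq one_pos), if_pos hm, sub_self]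

/-- **Bottom-class decomposition**: `G · F(t^q) = t^{q−1}·(Gt·F)(t^q) + (G − classPart_{q−1} G)·F(t^q)`. [folklore] -/
theorem mul_expand_eq {a : ℕ} {G Gt : K⟦X⟧} (hGt : ∀ r, coeff r Gt = coeff (p ^ a * r + (p ^ a - 1)) G)
    (F : K⟦X⟧) :
    G * expand (p ^ a) (pow_ne_zero a hp.out.ne_zero) F =
      X ^ (p ^ a - 1) * expand (p ^ a) (pow_ne_zero a hp.out.ne_zero) (Gt * F) +
        (G - classPart (p ^ a) (p ^ a - 1) G) * expand (p ^ a) (pow_ne_zero a hp.out.ne_zero) F := by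
  have hq : 0 < p ^ a := pow_pos hp.out.pos a
  have hcl : classPart (p ^ a) (p ^ a - 1) G = X ^ (p ^ a - 1) * expand (p ^ a) (pow_ne_zero a hp.out.ne_zero) Gt := by
    rw [classPart_eq_X_pow_mul_unitPart (Nat.sub_lt hq one_pos), unitPart_eq_expand p hGt]
  rw [map_mul]
  linear_combination (expand (p ^ a) (pow_ne_zero a hp.out.ne_zero) F) * hcl

/-- The order of the contracted class: `ord Gt = j₀` when `ord G = q·j₀ + (q−1)`. [folklore] -/
theorem order_contract {a j₀ : ℕ} {G Gt : K⟦X⟧} (hG : order G = (p ^ a * j₀ + (p ^ a - 1) : ℕ))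
    (hGt : ∀ r, coeff r Gt = coeff (p ^ a * r + (p ^ a - 1)) G) : order Gt = j₀ := by
  rw [order_eq_nat]
  refine ⟨?_, fun i hi => ?_⟩
  · rw [hGt]
    exact (order_eq_nat.mp hG).1
  · rw [hGt]
    apply coeff_of_lt_order
    rw [hG, Nat.cast_lt]
    have := Nat.mul_lt_mul_of_pos_left hi (pow_pos hp.out.pos a)
    omega

variable [CharP K p]

/-- **RENORMALISATION, one step.** If `ord G = q·j₀ + (q−1)` (`q = p^a`) and `Gt` is the contracted bottom class of `G`,
then for every `F` there is `F′` with `univStep (G·F(t^q)) = G·F′(t^q)` and `univStep (Gt·F) = Gt·F′`: the universal step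
of `G·F(t^q)` IS the universal step of `Gt·F` in the variable `u = t^q`. OURS (reduced model). [folklore] -/
theorem exists_univStep_eq_mul_expand {a j₀ : ℕ} {G Gt : K⟦X⟧} (hG : order G = (p ^ a * j₀ + (p ^ a - 1) : ℕ))
    (hGt : ∀ r, coeff r Gt = coeff (p ^ a * r + (p ^ a - 1)) G) (F : K⟦X⟧) :
    ∃ F' : K⟦X⟧, univStep (G * expand (p ^ a) (pow_ne_zero a hp.out.ne_zero) F) = G * expand (p ^ a) (pow_ne_zero a hp.out.ne_zero) F' ∧
      univStep (Gt * F) = Gt * F' := by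
  have hq : 0 < p ^ a := pow_pos hp.out.pos a
  have hq1 : p ^ a - 1 < p ^ a := Nat.sub_lt hq one_pos
  by_cases hF : F = 0
  · refine ⟨0, ?_, ?_⟩
    · rw [hF, map_zero, mul_zero, univStep_zero']
    · rw [hF, mul_zero, univStep_zero']
  obtain ⟨f, hf⟩ : ∃ f : ℕ, order F = f :=
    ENat.ne_top_iff_exists.mp (fun h => hF (order_eq_top.mp h)) |>.imp fun f hf => hf.symm
  have hGt0 : order Gt = j₀ := order_contract p hG hGt
  obtain ⟨j, hj⟩ : ∃ j : ℕ, j = j₀ + f := ⟨_, rfl⟩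
  obtain ⟨k, hk⟩ : ∃ k : ℕ, k = p ^ a * j + (p ^ a - 1) := ⟨_, rfl⟩
  obtain ⟨H, hH⟩ : ∃ H : K⟦X⟧, H = Gt * F := ⟨_, rfl⟩
  obtain ⟨β, hβ⟩ : ∃ β : K, β = coeff j H := ⟨_, rfl⟩
  -- orders and the bottom coefficient
  have hHord : order H = j := by
    rw [hH, order_mul, hGt0, hf, hj, Nat.cast_add]
  have hβ0 : β ≠ 0 := by
    rw [hβ]
    exact (order_eq_nat.mp hHord).1
  have hgord : order (G * expand (p ^ a) (pow_ne_zero a hp.out.ne_zero) F) = k := by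
    rw [order_mul, order_expand, hG, hf, nsmul_eq_mul, ← Nat.cast_mul, ← Nat.cast_add, hk, hj]
    congr 1
    ring
  -- the remainder has no bottom-class exponents, neither has `R·F(t^q)`
  have hRF : ∀ m, m % p ^ a = p ^ a - 1 →
      coeff m ((G - classPart (p ^ a) (p ^ a - 1) G) * expand (p ^ a) (pow_ne_zero a hp.out.ne_zero) F) = 0 :=
    coeff_mul_expand_eq_zero_of_mod (pow_ne_zero a hp.out.ne_zero) (coeff_sub_classPart_eq_zero hq G) F
  have hkmod : k % p ^ a = p ^ a - 1 := by
    rw [hk, Nat.mul_add_mod, Nat.mod_eq_of_lt hq1]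
  have hcoeff : coeff k (G * expand (p ^ a) (pow_ne_zero a hp.out.ne_zero) F) = β := by
    rw [mul_expand_eq p hGt F, map_add, hRF k hkmod, add_zero, coeff_X_pow_mul', if_pos (by omega),
      show k - (p ^ a - 1) = p ^ a * j by omega, coeff_expand_mul, hβ, hH]
  -- the universal step of `g`, unfolded
  have hstep : univStep (G * expand (p ^ a) (pow_ne_zero a hp.out.ne_zero) F) =
      -(C β⁻¹ * (G * expand (p ^ a) (pow_ne_zero a hp.out.ne_zero) F *
        D k (G * expand (p ^ a) (pow_ne_zero a hp.out.ne_zero) F - C β * X ^ k))) := by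
    rw [univStep, hgord, ENat.toNat_coe, univStepI, hcoeff]
  -- the derivative factor is the expansion of the derivative factor of `H`
  have hsub : G * expand (p ^ a) (pow_ne_zero a hp.out.ne_zero) F - C β * X ^ k =
      X ^ (p ^ a - 1) * expand (p ^ a) (pow_ne_zero a hp.out.ne_zero) (H - C β * X ^ j) +
        (G - classPart (p ^ a) (p ^ a - 1) G) * expand (p ^ a) (pow_ne_zero a hp.out.ne_zero) F := by
    rw [hH, map_sub, mul_expand_eq p hGt F, map_mul (expand (p ^ a) (pow_ne_zero a hp.out.ne_zero)) (C β), expand_C, map_pow,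
      expand_X, ← pow_mul, hk]
    ring
  have hD : D k (G * expand (p ^ a) (pow_ne_zero a hp.out.ne_zero) F - C β * X ^ k) =
      expand (p ^ a) (pow_ne_zero a hp.out.ne_zero) (D j (H - C β * X ^ j)) := by
    rw [hsub, map_add, hk, D_X_pow_mul_expand p, D_eq_zero_of_mod p hRF, add_zero]
  have hstepH : univStep H = -(C β⁻¹ * (H * D j (H - C β * X ^ j))) := by
    rw [univStep, hHord, ENat.toNat_coe, univStepI, ← hβ]
  refine ⟨-(C β⁻¹ * (F * D j (H - C β * X ^ j))), ?_, ?_⟩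
  · rw [hstep, hD, map_neg, map_mul, map_mul, expand_C]
    ring
  · rw [← hH, hstepH, hH]
    ring

/-- **RENORMALISATION (R).** If `ord G = q·j₀ + (q−1)` (`q = p^a`) and `Gt` is the contracted bottom class of `G`
(`coeff r Gt = coeff (q·r + (q−1)) G`), then along the whole universal run `univRun G i = G·F_i(t^q)` and
`univRun Gt i = Gt·F_i` with the SAME `F_i`: after a digit `≡ −1 (mod q)` the universal run is the universal run of the
contracted bottom class in the variable `u = t^q`. OURS (reduced model); the structure behind the self-similar digit tails of
the M48 census. [folklore] -/
theorem exists_univRun_eq_mul_expand {a j₀ : ℕ} {G Gt : K⟦X⟧} (hG : order G = (p ^ a * j₀ + (p ^ a - 1) : ℕ))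
    (hGt : ∀ r, coeff r Gt = coeff (p ^ a * r + (p ^ a - 1)) G) :
    ∀ i : ℕ, ∃ F : K⟦X⟧, univRun G i = G * expand (p ^ a) (pow_ne_zero a hp.out.ne_zero) F ∧ univRun Gt i = Gt * F
  | 0 => ⟨1, by rw [map_one, mul_one]; rfl, by rw [mul_one]; rfl⟩
  | i + 1 => by
    obtain ⟨F, hF, hFt⟩ := exists_univRun_eq_mul_expand hG hGt i
    obtain ⟨F', h1, h2⟩ := exists_univStep_eq_mul_expand p hG hGt F
    refine ⟨F', ?_, ?_⟩
    · show univStep (univRun G i) = _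
      rw [hF, h1]
    · show univStep (univRun Gt i) = _
      rw [hFt, h2]

/-- **DEATH IS RENORMALISATION-INVARIANT.** Under (R): `univRun G i = 0 ↔ univRun Gt i = 0`. [folklore] -/
theorem univRun_eq_zero_iff {a j₀ : ℕ} {G Gt : K⟦X⟧} (hG : order G = (p ^ a * j₀ + (p ^ a - 1) : ℕ))
    (hGt : ∀ r, coeff r Gt = coeff (p ^ a * r + (p ^ a - 1)) G) (i : ℕ) :
    univRun G i = 0 ↔ univRun Gt i = 0 := by
  obtain ⟨F, hF, hFt⟩ := exists_univRun_eq_mul_expand p hG hGt i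
  have hG0 : G ≠ 0 := fun h => by
    have := (order_eq_nat.mp hG).1
    rw [h, map_zero] at this
    exact this rfl
  have hGt0 : Gt ≠ 0 := fun h => by
    have := (order_eq_nat.mp (order_contract p hG hGt)).1
    rw [h, map_zero] at this
    exact this rfl
  rw [hF, hFt, mul_eq_zero, mul_eq_zero, or_iff_right hG0, or_iff_right hGt0]
  constructor
  · intro h
    ext n
    have := congr_arg (coeff (p ^ a * n)) h
    rw [coeff_expand_mul, map_zero] at this
    rw [this, map_zero]
  · intro h
    rw [h, map_zero]

/-- **DIGITS UNDER RENORMALISATION.** Under (R): if the run from `Gt` has bottom digit `κ` at state `i` then the run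
from `G` has bottom digit `q·κ + (q−1)` there. [folklore] -/
theorem order_univRun_renorm {a j₀ : ℕ} {G Gt : K⟦X⟧} (hG : order G = (p ^ a * j₀ + (p ^ a - 1) : ℕ))
    (hGt : ∀ r, coeff r Gt = coeff (p ^ a * r + (p ^ a - 1)) G) (i : ℕ) {κ : ℕ}
    (hκ : order (univRun Gt i) = κ) : order (univRun G i) = (p ^ a * κ + (p ^ a - 1) : ℕ) := by
  obtain ⟨F, hF, hFt⟩ := exists_univRun_eq_mul_expand p hG hGt i
  have hGt0 : order Gt = j₀ := order_contract p hG hGt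
  have hF0 : F ≠ 0 := fun h => by
    rw [h, mul_zero] at hFt
    rw [hFt, order_zero] at hκ
    exact ENat.top_ne_coe _ hκ
  obtain ⟨f, hf⟩ : ∃ f : ℕ, order F = f :=
    ENat.ne_top_iff_exists.mp (fun h => hF0 (order_eq_top.mp h)) |>.imp fun f hf => hf.symm
  have hκ' : κ = j₀ + f := by
    rw [hFt, order_mul, hGt0, hf, ← Nat.cast_add, Nat.cast_inj] at hκ
    exact hκ.symm
  rw [hF, order_mul, order_expand, hG, hf, hκ', nsmul_eq_mul, ← Nat.cast_mul, ← Nat.cast_add]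
  congr 1
  ring

end Renorm


end ReducedRun

end CampaignW24

end Summit.ResolutionOfSingularities.ResolutionOfSingularities.Theorems

end
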